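import Summits.MatrixMultiplication.MatrixMultiplication.Theorems.SoloInformedSupportDoor
import Summits.MatrixMultiplication.MatrixMultiplication.Theorems.SoloInformedTwistedCwBlocks

/-!
# The s-rank door in every permutation-block basis of `T_cw,q`

Solo deliverable (informed mode).  The s-rank door (`SoloInformedSupportDoor`:
`R̃_s(T_cw,2) = 3 ⇒ ω = 2`, graded `ω ≤ (3 log_q(4ρ³/27) − 2)/2`) is basis-dependent.  Here it is
proved for every twisted Coppersmith–Winograd tensor `T_cw,q^τ`, `τ ∈ S_q`
(`SoloInformedTwistedCwBlocks`): these are, up to relabelling the three bases separately, all the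
bases in which `T_cw,q` has the coarse laser support `{(0,1,1),(1,0,1),(1,1,0)}` with permutation
fine blocks.  For `q = 2` there are exactly two such supports up to relabelling: that of `T_cw,2`
(`τ = 1`) and that of the Levi-Civita-pattern tensor `P(i,j,k) = [i,j,k pairwise distinct]`
(`τ = (1 2)`), which is `GL₃(ℂ)^{×3}`-equivalent to `T_cw,2` but whose support is not a relabelling
of `supp T_cw,2`.  Both supports therefore carry a door:
`R_s(P^{⊗N}) = O(3^{(1+ε)N})` for every `ε > 0` implies `ω = 2`, and `ρ ≤ 3.16` implies
`ω < 2.36`.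

## References
* H. Cohn, C. Umans, *Fast matrix multiplication using coherent configurations*, SODA 2013,
  arXiv:1207.6528, §3 (p. 8) and Thm. 6. [CohnUmans2013]
* P. Bürgisser, M. Clausen, M. A. Shokrollahi, *Algebraic Complexity Theory* (1997), Thm. 15.41.
  [BurgisserClausenShokrollahi1997]
* A. Conner, F. Gesmundo, J. M. Landsberg, E. Ventura, *Rank and border rank of Kronecker powers
  of tensors and Strassen's laser method*, comput. complexity 31 (2022), arXiv:1909.04785.
  [ConnerGesmundoLandsbergVentura2022]
-/

noncomputable section

open scoped BigOperators
open Filter Asymptotics Finset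

namespace Summit.MatrixMultiplication.MatrixMultiplication.Theorems.SupportRankDoor

open Literature.Computability.AlgebraicComplexity

universe u

/-! ## Layer 1 for the twisted tensors -/

/-- `R_s(⟨|Δ|⟩ ⊗ ⟨q^m,q^m,q^m⟩) ≤ R_s((T_cw,q^τ)^{⊗3m})` with the Behrend-size `|Δ|`.
[cite: BurgisserClausenShokrollahi1997, Thm. 15.41 (proof, p. 381)] -/
theorem exists_supportRank_blocks_le_twisted (K : Type u) [Field K] (q m : ℕ)
    (τ : Equiv.Perm (Fin q)) (hm : 1 ≤ m) :
    ∃ p : ℕ, (3 * m).choose m * rothNumberNat (3 * (2 * m).choose m) ≤ 288 * (2 * m).choose m * p ∧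
      supportRank (kroneckerTensor (unitTensor K p) (matMulTensor K (q ^ m) (q ^ m) (q ^ m))) ≤
        supportRank (kroneckerPow (twistedCwTensor K q τ) (3 * m)) := by
  classical
  obtain ⟨Δ, hcard, hpart, hfree, hsize⟩ := exists_free_balanced_diagonal m hm
  obtain ⟨F, G, H, hFGH⟩ := twisted_kroneckerPow_blocks K q m (3 * m) τ Δ hcard hpart hfree
  refine ⟨Δ.card, hsize, ?_⟩
  rw [hFGH]
  exact supportRank_precomp_le _ F G H

/-- **`R̃_s(T_cw,q^τ) ≤ ρ ⇒ ω_s ≤ log_q(4ρ³/27)`** (growth form), for every twist `τ`.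
[cite: CohnUmans2013, §3 p. 8] -/
theorem omegaS_le_logb_of_supportRank_twisted_growth {q : ℕ} (hq : 2 ≤ q)
    (τ : Equiv.Perm (Fin q)) {ρ : ℝ} (hρ : 0 < ρ)
    (hyp : ∀ ε : ℝ, 0 < ε →
      (fun N : ℕ => (supportRank (kroneckerPow (twistedCwTensor ℂ q τ) N) : ℝ)) =O[atTop]
        fun N : ℕ => ρ ^ ((1 + ε) * N)) :
    omegaS ℂ ≤ Real.logb q (4 * ρ ^ 3 / 27) :=
  omegaS_le_logb_of_supportRank_laser (twistedCwTensor ℂ q τ) q hq ρ hρ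
    (fun m hm => exists_supportRank_blocks_le_twisted ℂ q m τ hm) hyp

/-- **`R̃_s(T_cw,q^τ) ≤ ρ ⇒ ω ≤ (3 log_q(4ρ³/27) − 2)/2`**, for every twist `τ`.
[cite: CohnUmans2013, Thm. 6] -/
theorem omega_le_of_supportRank_twisted_growth {q : ℕ} (hq : 2 ≤ q) (τ : Equiv.Perm (Fin q))
    {ρ : ℝ} (hρ : 0 < ρ)
    (hyp : ∀ ε : ℝ, 0 < ε →
      (fun N : ℕ => (supportRank (kroneckerPow (twistedCwTensor ℂ q τ) N) : ℝ)) =O[atTop]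
        fun N : ℕ => ρ ^ ((1 + ε) * N)) :
    omega ℂ ≤ (3 * Real.logb q (4 * ρ ^ 3 / 27) - 2) / 2 := by
  have h1 := CohnUmans2013Thm6.omega_le_three_mul_omegaS_sub_two_div_two (K := ℂ)
  have h2 := omegaS_le_logb_of_supportRank_twisted_growth hq τ hρ hyp
  linarith

/-- **The s-rank door for `T_cw,2^τ`, both twists**: `R_s((T_cw,2^τ)^{⊗N}) = O(3^{(1+ε)N})` for
every `ε > 0` implies `ω = 2`. [cite: CohnUmans2013, §3 p. 8] -/
theorem matrixMultiplication_of_supportRank_twistedCwTensor_two_growth (τ : Equiv.Perm (Fin 2))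
    (hyp : ∀ ε : ℝ, 0 < ε →
      (fun N : ℕ => (supportRank (kroneckerPow (twistedCwTensor ℂ 2 τ) N) : ℝ)) =O[atTop]
        fun N : ℕ => (3 : ℝ) ^ ((1 + ε) * N)) : _root_.MatrixMultiplication := by
  have h := omega_le_of_supportRank_twisted_growth (le_refl 2) τ (by norm_num : (0 : ℝ) < 3) hyp
  have hlog : Real.logb (2 : ℕ) (4 * (3 : ℝ) ^ 3 / 27) = 2 := by
    rw [show (4 * (3 : ℝ) ^ 3 / 27) = (2 : ℝ) ^ (2 : ℝ) by norm_num]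
    push_cast
    exact Real.logb_rpow (by norm_num) (by norm_num)
  rw [hlog] at h
  exact _root_.MatrixMultiplication_iff.2 (le_antisymm (by linarith) (omega_two_le ℂ))

/-- Width of the twisted doors: growth rate `ρ ≤ 3.16` implies `ω < 2.36`.
[cite: AlmanDuanVassilevskaWilliamsXuXuZhou2025, Thm. 1.1] -/
theorem omega_lt_of_supportRank_twistedCwTensor_two_growth (τ : Equiv.Perm (Fin 2)) {ρ : ℝ}
    (hρ : 0 < ρ) (hρ' : ρ ≤ 3.16)
    (hyp : ∀ ε : ℝ, 0 < ε →
      (fun N : ℕ => (supportRank (kroneckerPow (twistedCwTensor ℂ 2 τ) N) : ℝ)) =O[atTop]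
        fun N : ℕ => ρ ^ ((1 + ε) * N)) : omega ℂ < 2.36 := by
  have h := omega_le_of_supportRank_twisted_growth (le_refl 2) τ hρ hyp
  have hmono : Real.logb (2 : ℕ) (4 * ρ ^ 3 / 27) ≤ Real.logb 2 (4 * (3.16 : ℝ) ^ 3 / 27) := by
    push_cast
    exact Real.logb_le_logb_of_le one_lt_two (by positivity) (by gcongr)
  have hlt := logb_two_sLaser_bound_lt
  push_cast at h
  linarith

/-! ## The Levi-Civita-pattern basis of `T_cw,2` -/

section LC

variable (K : Type u) [Field K]

/-- **The Levi-Civita-pattern tensor** `P = ∑_{σ ∈ S₃} e_{σ(0)} ⊗ e_{σ(1)} ⊗ e_{σ(2)}`: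
`P(i,j,k) = [i, j, k pairwise distinct]`.  In the basis `f₀ = e₀+e₁+e₂`, `f₁ = e₀+ζe₁+ζ²e₂`,
`f₂ = e₀+ζ²e₁+ζe₂` (`ζ³ = 1`) one has `P ≅ T_cw,2` (both are the unique concise `1`-degenerate…
member of their pencil class; not used here), while `supp P` (the six permutations) is not a
relabelling of `supp T_cw,2`. [cite: ConnerGesmundoLandsbergVentura2022, §1] -/
def lcTensor : Fin 3 → Fin 3 → Fin 3 → K :=
  fun i j k => if i ≠ j ∧ j ≠ k ∧ i ≠ k then 1 else 0

/-- After swapping the labels `1, 2` in the first two factors, `P` is the twisted tensor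
`T_cw,2^{(1 2)}`: `T_cw,2^{(1 2)}(i,j,k) = P(s i, s j, k)` with `s = (1 2)`.
[cite: ConnerGesmundoLandsbergVentura2022, §1] -/
theorem twistedCwTensor_two_swap_eq_lcTensor_precomp :
    twistedCwTensor K 2 (Equiv.swap 0 1) = fun i j k =>
      lcTensor K (Equiv.swap (1 : Fin 3) 2 i) (Equiv.swap (1 : Fin 3) 2 j) k := by
  have key : ∀ i j k : Fin 3,
      ((i = 0 ∧ j = k ∧ j ≠ 0) ∨ (j = 0 ∧ i = k ∧ i ≠ 0) ∨
        (k = 0 ∧ j ≠ 0 ∧ i = twistSucc (Equiv.swap (0 : Fin 2) 1) j)) ↔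
      (Equiv.swap (1 : Fin 3) 2 i ≠ Equiv.swap (1 : Fin 3) 2 j ∧
        Equiv.swap (1 : Fin 3) 2 j ≠ k ∧ Equiv.swap (1 : Fin 3) 2 i ≠ k) := by
    decide
  funext i j k
  rw [twistedCwTensor_apply, lcTensor]
  simp only [key]

omit [Field K] in
/-- Kronecker powers commute with relabelling of indices. [cite: CohnUmans2013, §3] -/
theorem kroneckerPow_precomp_eq [CommSemiring K] {α β γ α' β' γ' : Type} [Fintype α] [Fintype β]
    [Fintype γ] [Fintype α'] [Fintype β'] [Fintype γ'] (t : α → β → γ → K) (f : α' → α)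
    (g : β' → β) (h : γ' → γ) (N : ℕ) :
    kroneckerPow (fun i j k => t (f i) (g j) (h k)) N =
      fun a b c => kroneckerPow t N (f ∘ a) (g ∘ b) (h ∘ c) := by
  funext a b c
  simp only [kroneckerPow_apply, Function.comp]

/-- `R_s((T_cw,2^{(1 2)})^{⊗N}) ≤ R_s(P^{⊗N})`: relabelling does not increase support rank.
[cite: CohnUmans2013, §3] -/
theorem supportRank_kroneckerPow_twisted_le_lc (N : ℕ) :
    supportRank (kroneckerPow (twistedCwTensor K 2 (Equiv.swap 0 1)) N) ≤
      supportRank (kroneckerPow (lcTensor K) N) := by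
  rw [twistedCwTensor_two_swap_eq_lcTensor_precomp, kroneckerPow_precomp_eq]
  exact supportRank_precomp_le _ _ _ _

/-- **The s-rank door in the Levi-Civita basis.** If `R_s(P^{⊗N}) = O(ρ^{(1+ε)N})` for every
`ε > 0` then `ω ≤ (3 log₂(4ρ³/27) − 2)/2`; in particular `ρ = 3` gives `ω = 2`.
[cite: CohnUmans2013, §3 p. 8] -/
theorem omega_le_of_supportRank_lcTensor_growth {ρ : ℝ} (hρ : 0 < ρ)
    (hyp : ∀ ε : ℝ, 0 < ε →
      (fun N : ℕ => (supportRank (kroneckerPow (lcTensor ℂ) N) : ℝ)) =O[atTop]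
        fun N : ℕ => ρ ^ ((1 + ε) * N)) :
    omega ℂ ≤ (3 * Real.logb (2 : ℕ) (4 * ρ ^ 3 / 27) - 2) / 2 := by
  refine omega_le_of_supportRank_twisted_growth (le_refl 2) (Equiv.swap 0 1) hρ fun ε hε => ?_
  refine IsBigO.trans ?_ (hyp ε hε)
  refine IsBigO.of_bound 1 (Filter.Eventually.of_forall fun N => ?_)
  rw [one_mul, Real.norm_natCast, Real.norm_natCast]
  exact_mod_cast supportRank_kroneckerPow_twisted_le_lc ℂ N

/-- **`R̃_s(P) = 3 ⇒ ω = 2`** (growth form) for the Levi-Civita-pattern tensor `P`.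
[cite: CohnUmans2013, §3 p. 8] -/
theorem matrixMultiplication_of_supportRank_lcTensor_growth
    (hyp : ∀ ε : ℝ, 0 < ε →
      (fun N : ℕ => (supportRank (kroneckerPow (lcTensor ℂ) N) : ℝ)) =O[atTop]
        fun N : ℕ => (3 : ℝ) ^ ((1 + ε) * N)) : _root_.MatrixMultiplication := by
  have h := omega_le_of_supportRank_lcTensor_growth (by norm_num : (0 : ℝ) < 3) hyp
  have hlog : Real.logb (2 : ℕ) (4 * (3 : ℝ) ^ 3 / 27) = 2 := by
    rw [show (4 * (3 : ℝ) ^ 3 / 27) = (2 : ℝ) ^ (2 : ℝ) by norm_num]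
    push_cast
    exact Real.logb_rpow (by norm_num) (by norm_num)
  rw [hlog] at h
  exact _root_.MatrixMultiplication_iff.2 (le_antisymm (by linarith) (omega_two_le ℂ))

/-- Width of the Levi-Civita door: `ρ ≤ 3.16` implies `ω < 2.36`.
[cite: AlmanDuanVassilevskaWilliamsXuXuZhou2025, Thm. 1.1] -/
theorem omega_lt_of_supportRank_lcTensor_growth {ρ : ℝ} (hρ : 0 < ρ) (hρ' : ρ ≤ 3.16)
    (hyp : ∀ ε : ℝ, 0 < ε →
      (fun N : ℕ => (supportRank (kroneckerPow (lcTensor ℂ) N) : ℝ)) =O[atTop]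
        fun N : ℕ => ρ ^ ((1 + ε) * N)) : omega ℂ < 2.36 := by
  have h := omega_le_of_supportRank_lcTensor_growth hρ hyp
  have hmono : Real.logb (2 : ℕ) (4 * ρ ^ 3 / 27) ≤ Real.logb 2 (4 * (3.16 : ℝ) ^ 3 / 27) := by
    push_cast
    exact Real.logb_le_logb_of_le one_lt_two (by positivity) (by gcongr)
  have hlt := logb_two_sLaser_bound_lt
  push_cast at h
  linarith

/-- The same for any re-weighting `T` of the six permutation points with `R̃(T) ≤ ρ` (growth
form): `ρ = 3` gives `ω = 2`. [cite: ConnerGesmundoLandsbergVentura2022, Thm. 1.1 and p. 3] -/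
theorem matrixMultiplication_of_sameSupport_lcTensor_rank_growth {T : Fin 3 → Fin 3 → Fin 3 → ℂ}
    (hT : SameSupport (lcTensor ℂ) T)
    (hyp : ∀ ε : ℝ, 0 < ε →
      (fun N : ℕ => (tensorRank (kroneckerPow T N) : ℝ)) =O[atTop]
        fun N : ℕ => (3 : ℝ) ^ ((1 + ε) * N)) : _root_.MatrixMultiplication :=
  matrixMultiplication_of_supportRank_lcTensor_growth
    (supportRank_growth_of_sameSupport_rank_growth hT hyp)

end LC

end Summit.MatrixMultiplication.MatrixMultiplication.Theorems.SupportRankDoor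

end
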